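import Summits.QuantumFields.YangMills.Theorems.BalabanUVNodesK0Stub1SectFWSlotOneLevel
import Summits.QuantumFields.YangMills.Theorems.BalabanUVNodesK0Stub1PairingsAtExtensions
import HarnessLib

/-!
# K0⁷ STUB 1 (`stub_prop8StepCoP13`), sub-target S4b, brick 14 (A6 ∕ junction smoke test of the capstone):
# **THE CAPSTONE's HYPOTHESIS BLOCK IS INHABITED AT THE RECORD's FLAT OPERATORS** — `exists_sectF_W_oneLevel` (p596653) FED with the pairings, extensions and
# transposes of `exists_pairings_transposes_flatOps` (brick 12: print's `Q_V, H_V, M_V, Qᵗ_V, Hᵗ_V` of a nested family, k0-s1-w1's extension shapes), the TRIVIAL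
# chart `D ≡ 0` and PER-LATTICE letters (row sums of the kernels; the averaging letter `q = 1` is the uniform one of brick 12): the whole pipeline g0 → bricks
# 8–12 elaborates end to end, and at the trivial chart it returns g0's V₀-current (`W = W₀`)

Cell `pub-ymgap`, width seat `pub-ymgap-k0-s1-w2` g2.  `--kind proof --supports stmt-QuantumFields-20541 --as helper`; count-neutral.  [15] = [Balaban1985Variational].

WHY.  The referee rule A6 (№189): a theorem whose hypotheses are uninhabited is vacuous — inhabit the antecedent or label the filing LOCATED.  The capstone displays
seven letters and the chart data as hypotheses; this file exhibits ONE inhabitant at every nested family `D : Domains P` with the operators OF RECORD (not zero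
operators): the structural hypotheses come from brick 12, the averaging letter is brick 12's uniform `q = 1`, the letters of `M_V`, `Qᵗ_V`, `Hᵗ_V` are PER-LATTICE
row sums of their kernels (finite, NOT uniform — uniformity is the port's [B6] Prop. 2.7 ∕ (46)), and the chart is the trivial one `D ≡ 0` (so (55), (57)–(58),
(73) hold with `C_D = θ₀ = 0`, `ℓ = 1`).  It is also the junction smoke test: g0's current, k0-s1-w1's extension shapes, UST's contraction and bricks 8–12 typecheck
together.

WHAT IS PROVED (sorry-free; no definition; axioms standard).
* §1 `norm_kernelSum_le` (`‖Σ_i c_i•X_i‖ ≤ (Σ_i |c_i|)·s` for `‖X_i‖ ≤ s`), `rowLetter_of_kernel` (a kernel-form map `X ↦ (t ↦ a•Σ_s c(s,t)•X s)` obeys the capstone's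
  letter shape with the per-lattice constant `‖a‖·Σ_t Σ_s |c(s,t)|`).
* §2 ★ `exists_sectF_W_oneLevel_inhabited_trivialChart` — for every `Params` (`4 ≤ d`), level `k`, nested family `D` (`c ≠ 0`, `w > 0`), fibre letters `ρ, τ` (g0's):
  the capstone's conclusion `∃ e W₀ W, …` at `Q := Q_V`, `H := H_V`, `M := M_V`, `Qt := Qᵗ_V`, `Ht := Hᵗ_V`, `BE` = (27), `B` = block trace pairing, `D ≡ 0`, `a₃ = 1/16`,
  with `W = W₀` on the nose and `C₄ = (d−1)‖ρ‖(64+138‖τ‖)` (g0's constant: at the trivial chart the H-groups vanish).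
HONEST SCOPE.  An INHABITANT (A6) and a typecheck of the junction, nothing more: the chart is trivial and three letters are per-lattice; the contentful inhabitant is S2's
chart + the port letters; nothing of [15]'s analysis asserted; `stub_prop8StepCoP13` ∕ K0⁷ NOT closed; N07 NOT discharged; counts unmoved (28∕28 · 5∕27); one finite
𝕋⁴ programme at fixed ε — R4 closes the conditional finite-𝕋⁴ rung `BalabanLadder.UV` only, never the summit; the YM mass gap (Clay) is NOT proved by any of this;
nothing continuum ∕ ℝ⁴ ∕ OS.  No `sorry`, no `def`, no `instance`, no `notation`.

References: [15] (27) p.282, (45) p.285, (88)–(90) p.291, Prop. 4 (97)–(98) pp.292–293, (157)–(158) p.302; [Balaban1984PropagatorsII] (2.20) p.226, (2.35) p.228.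
-/

set_option autoImplicit false

noncomputable section

namespace Summit.QuantumFields.YangMills.Theorems.K0Stub1CapstoneInhabited

open scoped BigOperators
open Literature.MathematicalPhysics.QuantumFieldTheory.Balaban1983to89
open B4Sect5Torus (TSite)
open B9Eq39Adjoint (bondPair)
open B9SectCLatticeCarrier (Bond)
open B11Eq115Space (NegSup JetSup)
open B11Eq111FrakG (nabla115)
open B11Eq63V0GroupCurrent (curV0)
open B11Eq26ActionExpansion (V0)
open B6SectADomainsV1 (Domains)
open B6SectAOperatorsV1 (BondIdx QE QsE aE)
open B6SectAVectorModelV1 (GE EE)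
open B6SectA (hOp)
open Summit.QuantumFields.YangMills.Theorems.K0Stub1SectFWSlotOneLevel (exists_sectF_W_oneLevel)
open Summit.QuantumFields.YangMills.Theorems.K0Stub1PairingsAtExtensions (exists_pairings_transposes_flatOps letterQ_QV_oneLevel)

/-! ## §1  Per-lattice row-sum letters for kernel-form maps -/

section RowLetters

variable {ι κ : Type*} [Fintype ι] [Fintype κ]
variable {𝔸 : Type*} [SeminormedAddCommGroup 𝔸] [NormedSpace ℂ 𝔸]

/-- `‖Σ_i c_i•X_i‖ ≤ (Σ_i |c_i|)·s` whenever `‖X_i‖ ≤ s` for all `i`. [folklore] -/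
theorem norm_kernelSum_le (c : ι → ℝ) (X : ι → 𝔸) {s : ℝ} (hX : ∀ i, ‖X i‖ ≤ s) :
    ‖∑ i, ((c i : ℝ) : ℂ) • X i‖ ≤ (∑ i, |c i|) * s := by
  calc ‖∑ i, ((c i : ℝ) : ℂ) • X i‖ ≤ ∑ i, ‖((c i : ℝ) : ℂ) • X i‖ := norm_sum_le _ _
    _ ≤ ∑ i, |c i| * s := Finset.sum_le_sum fun i _ => by
        rw [norm_smul, Complex.norm_real, Real.norm_eq_abs]
        exact mul_le_mul_of_nonneg_left (hX i) (abs_nonneg _)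
    _ = (∑ i, |c i|) * s := by rw [Finset.sum_mul]

/-- **PER-LATTICE ROW LETTER OF A KERNEL-FORM MAP**: if `T X t = a•Σ_s c(s,t)•X s` then `(∀ s, ‖X s‖ ≤ r) ⇒ ∀ t, ‖T X t‖ ≤ (‖a‖·Σ_t Σ_s |c(s,t)|)·r` (a finite
constant of THIS lattice — no uniformity claimed). [folklore] -/
theorem rowLetter_of_kernel (T : (ι → 𝔸) → (κ → 𝔸)) (a : ℂ) (c : ι → κ → ℝ)
    (hT : ∀ (X : ι → 𝔸) (t : κ), T X t = a • ∑ s, ((c s t : ℝ) : ℂ) • X s) (X : ι → 𝔸) (r : ℝ) (hX : ∀ s, ‖X s‖ ≤ r) (t : κ) :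
    ‖T X t‖ ≤ (‖a‖ * ∑ t', ∑ s, |c s t'|) * r := by
  rcases isEmpty_or_nonempty ι with hι | hι
  · have h0 : T X t = 0 := by rw [hT]; simp
    have hc0 : (∑ t' : κ, ∑ s : ι, |c s t'|) = 0 := by simp
    rw [h0, norm_zero, hc0, mul_zero, zero_mul]
  · obtain ⟨s₀⟩ := hι
    have hr : 0 ≤ r := (norm_nonneg _).trans (hX s₀)
    have hrow : ∑ s, |c s t| ≤ ∑ t', ∑ s, |c s t'| :=
      Finset.single_le_sum (f := fun t' => ∑ s, |c s t'|) (fun t' _ => Finset.sum_nonneg fun s _ => abs_nonneg _) (Finset.mem_univ t)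
    rw [hT, norm_smul]
    calc ‖a‖ * ‖∑ s, ((c s t : ℝ) : ℂ) • X s‖ ≤ ‖a‖ * ((∑ s, |c s t|) * r) :=
          mul_le_mul_of_nonneg_left (norm_kernelSum_le (fun s => c s t) X hX) (norm_nonneg _)
      _ ≤ ‖a‖ * ((∑ t', ∑ s, |c s t'|) * r) := by gcongr
      _ = (‖a‖ * ∑ t', ∑ s, |c s t'|) * r := by ring

end RowLetters

/-! ## §2  ★ The capstone fed with the operators of record, the trivial chart and per-lattice letters -/

section Inhabited

variable {P : Params}
variable {𝔸 : Type*} [NormedRing 𝔸] [NormedAlgebra ℂ 𝔸] [CompleteSpace 𝔸] [NormOneClass 𝔸] [StarRing 𝔸] [StarModule ℂ 𝔸]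
  [FiniteDimensional ℂ 𝔸]

open scoped Classical in
/-- ★ **THE CAPSTONE's HYPOTHESIS BLOCK IS INHABITED AT THE RECORD's FLAT OPERATORS (trivial chart, per-lattice letters).**  For every `Params` with `4 ≤ d`, level `k`,
nested family `D` (`c ≠ 0`, weights `w > 0`) and fibre letters `ρ, τ` as in g0's current: `exists_sectF_W_oneLevel` applies to `Q_V, H_V, M_V, Qᵗ_V, Hᵗ_V` and the pairings
of `exists_pairings_transposes_flatOps`, with `D ≡ 0`, `a₃ = 1/16`, `ℓ = 1`, `C_D = θ₀ = 0`, the uniform averaging letter `q = 1` and per-lattice row-sum letters for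
`M_V`, `Qᵗ_V`, `Hᵗ_V` — and returns `∃ e W₀ W` with `W = W₀` (the H-groups vanish at the trivial chart), the (63)-certificate for `V₀`, holomorphy, and the slot with
g0's constant. [cite: Balaban1985Variational, Prop. 4 (97)–(98) pp.292–293, (157)–(158) p.302] -/
theorem exists_sectF_W_oneLevel_inhabited_trivialChart (P : Params) (hd : 4 ≤ P.d) (k : ℕ) [Fact ((0 : ℝ) < (P.L : ℝ))]
    [Fact ((0 : ℝ) < ((P.L : ℝ))⁻¹ ^ k)] (D : Domains P) {c : ℝ} (hc : c ≠ 0) {w : BondIdx D → ℝ} (hw : ∀ i, 0 < w i)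
    (ρ : (𝔸 →L[ℂ] ℂ) →L[ℂ] 𝔸) (τ : 𝔸 →L[ℂ] ℂ) (hρ : ∀ (ℓ' : 𝔸 →L[ℂ] ℂ) (X : 𝔸), τ (ρ ℓ' * X) = ℓ' X)
    (hτ : ∀ a b : 𝔸, τ (a * b) = τ (b * a)) (hτs : ∀ a : 𝔸, τ (star a) = starRingEnd ℂ (τ a)) (hτ1 : ∀ X : 𝔸, ‖τ X‖ ≤ ‖X‖) :
    ∃ (e : Site P 0 ≃ TSite P.d (fun _ => P.sitesPerDir 0)) (W₀ W : (PBond P 0 → 𝔸) → (PBond P 0 → 𝔸)),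
      (∀ (x : Site P 0) (μ : Fin P.d), e (x.shift μ) = B9SectCLatticeCarrier.shift μ (e x)) ∧
      (∀ A' : PBond P 0 → 𝔸, W A' = W₀ A') ∧
      DifferentiableOn ℂ W {Y : PBond P 0 → 𝔸 | (∀ b, ‖Y b‖ < 1 / 16) ∧
        ∀ (s : Site P 0) (μ ν : Fin P.d), (P.L : ℝ) ^ k * ‖Y ⟨s.shift ν, μ⟩ - Y ⟨s, μ⟩‖ < 1 / 16} ∧
      (∀ (Y : PBond P 0 → 𝔸) (r : ℝ), r < 1 / 16 → (∀ b, ‖Y b‖ ≤ r) →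
        (∀ (s : Site P 0) (μ ν : Fin P.d), (P.L : ℝ) ^ k * ‖Y ⟨s.shift ν, μ⟩ - Y ⟨s, μ⟩‖ ≤ r) →
        ∀ b, ‖W Y b‖ ≤ (((P.d - 1 : ℕ) : ℝ) * ‖ρ‖ * (64 + 138 * ‖τ‖)) * r ^ 2) := by
  have hη : (((P.L : ℝ))⁻¹ ^ k) ≠ 0 := (Fact.out : (0 : ℝ) < ((P.L : ℝ))⁻¹ ^ k).ne'
  obtain ⟨BE, B, QV, HV, MV, QtV, HtV, hBE, hB, hQV, hHV, hMV, hQtV, hHtV, hBsymm, hM, hQt, hHt⟩ :=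
    exists_pairings_transposes_flatOps D hc hw (𝔸 := 𝔸) hη (τ : 𝔸 →ₗ[ℂ] ℂ) hτ
  -- per-lattice row letters of `M_V`, `Qᵗ_V`, `Hᵗ_V`
  have hMrow := rowLetter_of_kernel (MV : (BondIdx D → 𝔸) → (BondIdx D → 𝔸)) 1
    (fun s t => (WithLp.ofLp ((EE D hc hw - aE D w) (WithLp.toLp 2 (Pi.single s 1))) t : ℝ)) (fun X t => by rw [one_smul]; exact hMV X t)
  have hQtrow := rowLetter_of_kernel (QtV : (BondIdx D → 𝔸) → (PBond P 0 → 𝔸)) ((((((P.L : ℝ))⁻¹ ^ k : ℝ) : ℂ) ^ P.d)⁻¹)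
    (fun t j => (WithLp.ofLp (QE D (WithLp.toLp 2 (Pi.single j 1))) t : ℝ)) (fun X j => hQtV X j)
  have hHtrow := rowLetter_of_kernel (HtV : (PBond P 0 → 𝔸) → (BondIdx D → 𝔸)) (((((P.L : ℝ))⁻¹ ^ k : ℝ) : ℂ) ^ P.d)
    (fun b t => (WithLp.ofLp (hOp (GE D hc hw) (QsE D) (EE D hc hw) (WithLp.toLp 2 (Pi.single t 1))) b : ℝ)) (fun Z t => hHtV Z t)
  obtain ⟨e, W₀, W, he, -, hWformula, -, hWd, hWq⟩ := exists_sectF_W_oneLevel P hd k ρ τ hρ hτ hτs hτ1 BE hBE B hBsymm QV MV hM HV QtV hQt HtV hHt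
    (a₃ := 1 / 16) (fun _ : PBond P 0 → 𝔸 => (0 : BondIdx D → 𝔸))
    (fun _ : PBond P 0 → 𝔸 => (0 : (PBond P 0 → 𝔸) →L[ℂ] (BondIdx D → 𝔸)))
    (fun _ : PBond P 0 → 𝔸 => (0 : (BondIdx D → 𝔸) →L[ℂ] (PBond P 0 → 𝔸)))
    (fun A' _ _ => hasFDerivAt_const (𝕜 := ℂ) (0 : BondIdx D → 𝔸) A')
    (fun A' _ _ X δ => by simp)
    (differentiableOn_const _) (differentiableOn_const _)
    (fun _ => (1 : ℝ)) (fun _ => (1 : ℝ)) (fun _ => zero_le_one)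
    (O₁ := ‖(1 : ℂ)‖ * ∑ t', ∑ s, |(WithLp.ofLp ((EE D hc hw - aE D w) (WithLp.toLp 2 (Pi.single s 1))) t' : ℝ)|)
    (q₀ := ‖((((((P.L : ℝ))⁻¹ ^ k : ℝ) : ℂ) ^ P.d)⁻¹)‖ * ∑ j, ∑ t, |(WithLp.ofLp (QE D (WithLp.toLp 2 (Pi.single j 1))) t : ℝ)|)
    (θ₀ := 0)
    (h₀ := ‖(((((P.L : ℝ))⁻¹ ^ k : ℝ) : ℂ) ^ P.d)‖ * ∑ t, ∑ b, |(WithLp.ofLp (hOp (GE D hc hw) (QsE D) (EE D hc hw) (WithLp.toLp 2 (Pi.single t 1))) b : ℝ)|)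
    (CD := 0) (q := 1) (ℓ := 1)
    (by positivity) le_rfl (by positivity) le_rfl zero_le_one (by norm_num)
    (fun X s hX i => by rw [one_mul]; exact hMrow X s (fun j => by simpa using hX j) i)
    (fun X s hX b => hQtrow X s (fun j => by simpa using hX j) b)
    (fun A' r _ _ _ X s _ b => by simp)
    (fun Z s hZ i => by rw [one_mul]; exact hHtrow Z s hZ i)
    (fun A' r _ _ _ i => by simp)
    (fun A' r hA' i => letterQ_QV_oneLevel D QV hQV A' r hA' i)
    (fun A' r h0 h1 _ => ⟨fun b => by simpa using h0 b, fun s μ ν => by simpa using h1 s μ ν⟩)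
  refine ⟨e, W₀, W, he, fun A' => ?_, hWd, fun Y r hr h0 h1 b => ?_⟩
  · rw [hWformula]; simp
  · have h := hWq Y r hr h0 h1 b
    simpa using h

end Inhabited

end Summit.QuantumFields.YangMills.Theorems.K0Stub1CapstoneInhabited

end
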